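import Literature.Analysis.UnboundedOperators.HeatKernelHeatEquation
import Literature.Analysis.UnboundedOperators.HeatKernelBoundedData
import Literature.Analysis.UnboundedOperators.HeatFlowCalculus
import HarnessLib

/-!
# The heat flow of time-dependent data: Duhamel's formula for a classical field

Analysis/UnboundedOperators support file (everything proved; no definitions, no named facts) on
the proof path of the corrected perturbation theorem of M. P. Coiculescu, S. Palasek, Invent.
Math. 244 (2025), arXiv:2503.14699, Props. 4.2–4.3 (hypothesis `hB`, `κ ≤ α`, of
`Literature.Barriers.NavierStokesRegularity.CoiculescuPalasek2025_construction_of_parts'`): the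
principal part `v` is a CLASSICAL solution, and the perturbation argument is run on the MILD
equation, so one needs the Duhamel formula for `v` ("the semigroup obeys the Duhamel formula",
§4.2; `w(t) = ∫₀ᵗ e^{(t-t')Δ}P div(…)`, §4.3). This file proves its heat-flow half, for a bounded
classical field on the whole space:

* `HeatFlow.hasDerivAt_heatExtension_timeDependent` — for a family `u τ : E → F` of bounded `C²`
  slices with bounded first and second derivatives, differentiable in `τ` pointwise with a
  bounded time derivative `∂u` which is Lipschitz in `τ` uniformly in space, the function
  `Ψ(τ) = e^{(t-τ)Δ}u(τ)(y)` has the derivative `e^{(t-τ)Δ}(∂u(τ) - Δu(τ))(y)` for `τ < t`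
  (derivative in the data slot by linearity and the sup-norm contraction of `e^{σΔ}`; derivative
  in the time slot from the tree's heat equation `hasDerivAt_heatExtension_time` and
  `laplacian_heatExtension_of_bounded`);
* `HeatFlow.eq_heatExtension_add_integral` — **Duhamel's formula**: for `s < t`,
  `u(t)(y) = e^{(t-s)Δ}u(s)(y) + ∫ₛᵗ e^{(t-τ)Δ}q(τ)(y) dτ`, `q = ∂u - Δu` (fundamental theorem of
  calculus on `[s, t']` and `t' ↑ t`, using `e^{σΔ}g → g` as `σ ↓ 0` at continuity points,
  `tendsto_heatExtension_nhdsGT_zero_of_continuousAt`).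

All hypotheses are elementary bounds, discharged for a smooth periodic field on a compact time
interval by compactness; `q` is `-(v·∇)v - ∇π - div F` for the paper's `v` by (4.1).

## References

* M. P. Coiculescu, S. Palasek, Invent. Math. 244 (2025) = arXiv:2503.14699, §4.2 (Duhamel
  formula for the semigroup), §4.3 (Duhamel formula for `w`). [CoiculescuPalasek2025]
* L. C. Evans, *Partial Differential Equations*, 2nd ed., §2.3.1 (c) (Duhamel's principle for
  the heat equation). [folklore]
-/

noncomputable section

open MeasureTheory Set Function Filter Metric Real Asymptotics
open _root_.Topology
open scoped ENNReal NNReal Laplacian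

namespace Literature.Analysis.UnboundedOperators

namespace HeatFlow

variable {E : Type*} [NormedAddCommGroup E] [InnerProductSpace ℝ E] [FiniteDimensional ℝ E]
  [MeasurableSpace E] [BorelSpace E]
variable {F : Type*} [NormedAddCommGroup F] [NormedSpace ℝ F] [CompleteSpace F]

/-! ### Elementary consequences of the hypotheses -/

omit [NormedAddCommGroup E] [InnerProductSpace ℝ E] [FiniteDimensional ℝ E] [MeasurableSpace E]
  [BorelSpace E] [CompleteSpace F] in
/-- **Taylor remainder in time from a Lipschitz time derivative**: if `φ` has derivative `dφ σ`
on `(a, b)` and `‖dφ σ' - dφ σ‖ ≤ L|σ' - σ|`, then for `τ, τ' ∈ (a, b)`,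
`‖φ τ' - φ τ - (τ' - τ) • dφ τ‖ ≤ L |τ' - τ|²` (mean value inequality for
`σ ↦ φ σ - σ • dφ τ`). [folklore] -/
theorem norm_sub_sub_smul_le_of_lipschitz_deriv {φ dφ : ℝ → F} {a b L : ℝ} (hL0 : 0 ≤ L)
    (hd : ∀ σ ∈ Ioo a b, HasDerivAt φ (dφ σ) σ)
    (hL : ∀ σ ∈ Ioo a b, ∀ σ' ∈ Ioo a b, ‖dφ σ' - dφ σ‖ ≤ L * |σ' - σ|)
    {τ τ' : ℝ} (hτ : τ ∈ Ioo a b) (hτ' : τ' ∈ Ioo a b) :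
    ‖φ τ' - φ τ - (τ' - τ) • dφ τ‖ ≤ L * |τ' - τ| ^ 2 := by
  set g : ℝ → F := fun σ => φ σ - σ • dφ τ with hg
  have hseg : uIcc τ τ' ⊆ Ioo a b := by
    rcases le_total τ τ' with h | h
    · rw [uIcc_of_le h]; exact fun σ hσ => ⟨hτ.1.trans_le hσ.1, hσ.2.trans_lt hτ'.2⟩
    · rw [uIcc_of_ge h]; exact fun σ hσ => ⟨hτ'.1.trans_le hσ.1, hσ.2.trans_lt hτ.2⟩
  have hderiv : ∀ σ ∈ uIcc τ τ', HasDerivWithinAt g (dφ σ - dφ τ) (uIcc τ τ') σ := by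
    intro σ hσ
    have h2 : HasDerivAt (fun σ' : ℝ => σ' • dφ τ) ((1 : ℝ) • dφ τ) σ :=
      (hasDerivAt_id σ).smul_const _
    rw [one_smul] at h2
    exact ((hd σ (hseg hσ)).sub h2).hasDerivWithinAt
  have habs : ∀ σ ∈ uIcc τ τ', |σ - τ| ≤ |τ' - τ| := by
    intro σ hσ
    rcases le_total τ τ' with h | h
    · rw [uIcc_of_le h] at hσ
      rw [abs_of_nonneg (by linarith [hσ.1]), abs_of_nonneg (by linarith)]; linarith [hσ.2]
    · rw [uIcc_of_ge h] at hσ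
      rw [abs_of_nonpos (by linarith [hσ.2]), abs_of_nonpos (by linarith)]; linarith [hσ.1]
  have hbound : ∀ σ ∈ uIcc τ τ', ‖dφ σ - dφ τ‖ ≤ L * |τ' - τ| := fun σ hσ =>
    (hL τ hτ σ (hseg hσ)).trans (mul_le_mul_of_nonneg_left (habs σ hσ) hL0)
  have key := (convex_uIcc τ τ').norm_image_sub_le_of_norm_hasDerivWithin_le hderiv hbound
    left_mem_uIcc right_mem_uIcc
  have e1 : g τ' - g τ = φ τ' - φ τ - (τ' - τ) • dφ τ := by
    simp only [hg, sub_smul]; abel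
  rw [← e1]
  calc ‖g τ' - g τ‖ ≤ L * |τ' - τ| * ‖τ' - τ‖ := key
    _ = L * |τ' - τ| ^ 2 := by rw [Real.norm_eq_abs]; ring

omit [NormedAddCommGroup E] [InnerProductSpace ℝ E] [FiniteDimensional ℝ E] [MeasurableSpace E]
  [BorelSpace E] [CompleteSpace F] in
/-- Mean value bound in time: `‖φ τ' - φ τ‖ ≤ D |τ' - τ|` if `‖dφ‖ ≤ D` on `(a, b)`. [folklore] -/
theorem norm_sub_le_of_deriv_bound {φ dφ : ℝ → F} {a b D : ℝ}
    (hd : ∀ σ ∈ Ioo a b, HasDerivAt φ (dφ σ) σ) (hD : ∀ σ ∈ Ioo a b, ‖dφ σ‖ ≤ D)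
    {τ τ' : ℝ} (hτ : τ ∈ Ioo a b) (hτ' : τ' ∈ Ioo a b) : ‖φ τ' - φ τ‖ ≤ D * |τ' - τ| := by
  have hseg : uIcc τ τ' ⊆ Ioo a b := by
    rcases le_total τ τ' with h | h
    · rw [uIcc_of_le h]; exact fun σ hσ => ⟨hτ.1.trans_le hσ.1, hσ.2.trans_lt hτ'.2⟩
    · rw [uIcc_of_ge h]; exact fun σ hσ => ⟨hτ'.1.trans_le hσ.1, hσ.2.trans_lt hτ.2⟩
  have key := (convex_uIcc τ τ').norm_image_sub_le_of_norm_hasDerivWithin_le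
    (fun σ hσ => (hd σ (hseg hσ)).hasDerivWithinAt) (fun σ hσ => hD σ (hseg hσ))
    left_mem_uIcc right_mem_uIcc
  rwa [Real.norm_eq_abs] at key

/-! ### Continuity and differentiability of `τ ↦ e^{(t-τ)Δ} h(τ)` -/

omit [CompleteSpace F] in
/-- **Continuity of the heat flow of Lipschitz-in-time data along `σ = t - τ`**: if the slices
`h τ` are continuous and bounded by `D` and `‖h τ' z - h τ z‖ ≤ L|τ' - τ|` on `(a, b)`, then
`τ ↦ e^{(t-τ)Δ}h(τ)(y)` is continuous at every `τ ∈ (a, b)` with `τ < t`. [folklore] -/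
theorem continuousAt_heatExtension_timeDependent {h : ℝ → E → F} {a b D L t : ℝ} (hL0 : 0 ≤ L)
    (hc : ∀ τ ∈ Ioo a b, Continuous (h τ)) (h0 : ∀ τ ∈ Ioo a b, ∀ z, ‖h τ z‖ ≤ D)
    (hL : ∀ τ ∈ Ioo a b, ∀ τ' ∈ Ioo a b, ∀ z, ‖h τ' z - h τ z‖ ≤ L * |τ' - τ|)
    {τ : ℝ} (hτ : τ ∈ Ioo a b) (hτt : τ < t) (y : E) :
    ContinuousAt (fun σ => heatExtension (h σ) (t - σ) y) τ := by
  have hσ₀ : 0 < t - τ := sub_pos.2 hτt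
  -- continuity in the time slot at `t - τ`
  have hm : MemLp (h τ) ∞ (volume : Measure E) := memLp_top_of_continuous_of_bound (hc τ hτ) (h0 τ hτ)
  have hcontσ : ContinuousAt (fun σ => heatExtension (h τ) σ y) (t - τ) :=
    (continuousOn_heatExtension_time hm le_top y).continuousAt (Ioi_mem_nhds hσ₀)
  have hcomp : Tendsto (fun σ => heatExtension (h τ) (t - σ) y) (𝓝 τ)
      (𝓝 (heatExtension (h τ) (t - τ) y)) :=
    hcontσ.tendsto.comp ((continuous_const.sub continuous_id).tendsto τ)
  -- the data slot is Lipschitz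
  rw [ContinuousAt, Metric.tendsto_nhds]
  intro ε hε
  have h1 : ∀ᶠ σ in 𝓝 τ, dist (heatExtension (h τ) (t - σ) y) (heatExtension (h τ) (t - τ) y) < ε / 2 :=
    Metric.tendsto_nhds.1 hcomp (ε / 2) (half_pos hε)
  have h2 : ∀ᶠ σ in 𝓝 τ, σ ∈ Ioo a b ∧ σ < t := by
    filter_upwards [Ioo_mem_nhds hτ.1 hτ.2, Iio_mem_nhds hτt] with σ h1 h2
    exact ⟨h1, h2⟩
  have h3 : ∀ᶠ σ in 𝓝 τ, L * |σ - τ| < ε / 2 := by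
    have : Tendsto (fun σ => L * |σ - τ|) (𝓝 τ) (𝓝 (L * |τ - τ|)) :=
      (continuous_const.mul ((continuous_id.sub continuous_const).abs)).tendsto τ
    simp only [sub_self, abs_zero, mul_zero] at this
    exact (Metric.tendsto_nhds.1 this (ε / 2) (half_pos hε)).mono fun σ hσ => by
      simpa [Real.dist_eq, abs_mul, abs_abs, abs_of_nonneg hL0] using hσ
  filter_upwards [h1, h2, h3] with σ hσ1 hσ2 hσ3
  have hσp : 0 < t - σ := sub_pos.2 hσ2.2
  have hsplit : heatExtension (h σ) (t - σ) y - heatExtension (h τ) (t - τ) y =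
      heatExtension (fun z => h σ z - h τ z) (t - σ) y +
        (heatExtension (h τ) (t - σ) y - heatExtension (h τ) (t - τ) y) := by
    rw [heatExtension_sub_of_bound (hc σ hσ2.1) (hc τ hτ) (h0 σ hσ2.1) (h0 τ hτ) hσp]
    abel
  rw [dist_eq_norm, hsplit]
  calc ‖heatExtension (fun z => h σ z - h τ z) (t - σ) y +
        (heatExtension (h τ) (t - σ) y - heatExtension (h τ) (t - τ) y)‖
      ≤ ‖heatExtension (fun z => h σ z - h τ z) (t - σ) y‖ +
          ‖heatExtension (h τ) (t - σ) y - heatExtension (h τ) (t - τ) y‖ := norm_add_le _ _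
    _ < ε / 2 + ε / 2 := by
        refine add_lt_add_of_le_of_lt ?_ (by rwa [dist_eq_norm] at hσ1)
        exact (norm_heatExtension_le (fun z => hL τ hτ σ hσ2.1 z) hσp y).trans hσ3.le
    _ = ε := by ring

/-- **The derivative of `τ ↦ e^{(t-τ)Δ}u(τ)(y)`** for a family of bounded `C²` slices with bounded
derivatives up to order two, differentiable in `τ` with a bounded time derivative `∂u` Lipschitz
in `τ` uniformly in space: for `τ < t`,
`d/dτ e^{(t-τ)Δ}u(τ)(y) = e^{(t-τ)Δ}∂u(τ)(y) - e^{(t-τ)Δ}Δu(τ)(y)` (the heat equation for `e^{σΔ}` in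
`σ`, `hasDerivAt_heatExtension_time` with `laplacian_heatExtension_of_bounded`, and the derivative
in the data slot by linearity and the sup-norm contraction). [cite: CoiculescuPalasek2025, §4.2 (the Duhamel formula for the semigroup of the linearisation)] -/
theorem hasDerivAt_heatExtension_timeDependent {u du : ℝ → E → F} {a b B B₁ B₂ D L t : ℝ}
    (hL0 : 0 ≤ L) (hC2 : ∀ τ ∈ Ioo a b, ContDiff ℝ 2 (u τ))
    (hu0 : ∀ τ ∈ Ioo a b, ∀ z, ‖u τ z‖ ≤ B) (hu1 : ∀ τ ∈ Ioo a b, ∀ z, ‖fderiv ℝ (u τ) z‖ ≤ B₁)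
    (hu2 : ∀ τ ∈ Ioo a b, ∀ z, ‖fderiv ℝ (fderiv ℝ (u τ)) z‖ ≤ B₂)
    (hdu : ∀ τ ∈ Ioo a b, ∀ z, HasDerivAt (fun σ => u σ z) (du τ z) τ)
    (hduc : ∀ τ ∈ Ioo a b, Continuous (du τ)) (hdu0 : ∀ τ ∈ Ioo a b, ∀ z, ‖du τ z‖ ≤ D)
    (hduL : ∀ τ ∈ Ioo a b, ∀ τ' ∈ Ioo a b, ∀ z, ‖du τ' z - du τ z‖ ≤ L * |τ' - τ|)
    {τ : ℝ} (hτ : τ ∈ Ioo a b) (hτt : τ < t) (y : E) :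
    HasDerivAt (fun σ => heatExtension (u σ) (t - σ) y)
      (heatExtension (du τ) (t - τ) y - heatExtension (fun z => (Δ (u τ)) z) (t - τ) y) τ := by
  have hσ₀ : 0 < t - τ := sub_pos.2 hτt
  have huc : ∀ τ ∈ Ioo a b, Continuous (u τ) := fun τ hτ => (hC2 τ hτ).continuous
  -- ### (i) the time slot
  have hm : MemLp (u τ) ∞ (volume : Measure E) := memLp_top_of_continuous_of_bound (huc τ hτ) (hu0 τ hτ)
  have hi : HasDerivAt (fun σ => heatExtension (u τ) (t - σ) y)
      (-heatExtension (fun z => (Δ (u τ)) z) (t - τ) y) τ := by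
    have hd := hasDerivAt_heatExtension_time hσ₀ hm le_top y
    rw [laplacian_heatExtension_of_bounded (hC2 τ hτ) (hu0 τ hτ) (hu1 τ hτ) (hu2 τ hτ) hσ₀ y] at hd
    have hcomp := hd.scomp τ ((hasDerivAt_id τ).const_sub t)
    simpa [Function.comp_def, neg_one_smul] using hcomp
  -- ### (ii) the data slot
  have hii : HasDerivAt (fun σ => heatExtension (u σ) (t - σ) y - heatExtension (u τ) (t - σ) y)
      (heatExtension (du τ) (t - τ) y) τ := by
    rw [hasDerivAt_iff_isLittleO_nhds_zero]
    simp only [sub_self, sub_zero]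
    -- continuity in the time slot of `e^{σΔ}(∂u τ)` at `t - τ`
    have hmdu : MemLp (du τ) ∞ (volume : Measure E) := memLp_top_of_continuous_of_bound (hduc τ hτ) (hdu0 τ hτ)
    have hcontσ : Tendsto (fun h : ℝ => heatExtension (du τ) (t - (τ + h)) y) (𝓝 0)
        (𝓝 (heatExtension (du τ) (t - τ) y)) := by
      have hca : ContinuousAt (fun σ => heatExtension (du τ) σ y) (t - τ) :=
        (continuousOn_heatExtension_time hmdu le_top y).continuousAt (Ioi_mem_nhds hσ₀)
      have hlin : Tendsto (fun h : ℝ => t - (τ + h)) (𝓝 0) (𝓝 (t - τ)) := by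
        have hc : Continuous fun h : ℝ => t - (τ + h) := by fun_prop
        simpa using hc.tendsto (0 : ℝ)
      exact hca.tendsto.comp hlin
    refine Asymptotics.isLittleO_iff.2 fun ε hε => ?_
    have h1 : ∀ᶠ h : ℝ in 𝓝 0, ‖heatExtension (du τ) (t - (τ + h)) y - heatExtension (du τ) (t - τ) y‖ < ε / 2 := by
      have := Metric.tendsto_nhds.1 hcontσ (ε / 2) (half_pos hε)
      exact this.mono fun h hh => by rwa [dist_eq_norm] at hh
    have h2 : ∀ᶠ h : ℝ in 𝓝 0, τ + h ∈ Ioo a b ∧ τ + h < t := by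
      have ht : Tendsto (fun h : ℝ => τ + h) (𝓝 0) (𝓝 τ) := by
        have hc : Continuous fun h : ℝ => τ + h := by fun_prop
        simpa using hc.tendsto (0 : ℝ)
      filter_upwards [ht (Ioo_mem_nhds hτ.1 hτ.2), ht (Iio_mem_nhds hτt)] with h hh1 hh2
      exact ⟨hh1, hh2⟩
    have h3 : ∀ᶠ h : ℝ in 𝓝 0, L * |h| ≤ ε / 2 := by
      have : Tendsto (fun h : ℝ => L * |h|) (𝓝 0) (𝓝 (L * |(0:ℝ)|)) :=
        (continuous_const.mul continuous_abs).tendsto 0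
      simp only [abs_zero, mul_zero] at this
      exact (Metric.tendsto_nhds.1 this (ε / 2) (half_pos hε)).mono fun h hh => by
        have h' : abs (L * |h|) < ε / 2 := by simpa [Real.dist_eq] using hh
        exact (le_abs_self _).trans h'.le
    filter_upwards [h1, h2, h3] with h hh1 hh2 hh3
    have hσp : 0 < t - (τ + h) := sub_pos.2 hh2.2
    -- the algebra: linearity of `e^{σΔ}` in the data
    have hsub : heatExtension (u (τ + h)) (t - (τ + h)) y - heatExtension (u τ) (t - (τ + h)) y =
        heatExtension (fun z => u (τ + h) z - u τ z) (t - (τ + h)) y :=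
      (heatExtension_sub_of_bound (huc _ hh2.1) (huc τ hτ) (hu0 _ hh2.1) (hu0 τ hτ) hσp y).symm
    have hsmul : h • heatExtension (du τ) (t - (τ + h)) y =
        heatExtension (fun z => h • du τ z) (t - (τ + h)) y :=
      (heatExtension_const_smul h (du τ) _ y).symm
    have hkey : heatExtension (u (τ + h)) (t - (τ + h)) y - heatExtension (u τ) (t - (τ + h)) y -
        h • heatExtension (du τ) (t - τ) y =
        heatExtension (fun z => u (τ + h) z - u τ z - h • du τ z) (t - (τ + h)) y +
          h • (heatExtension (du τ) (t - (τ + h)) y - heatExtension (du τ) (t - τ) y) := by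
      have hc1 : Continuous fun z => u (τ + h) z - u τ z := (huc _ hh2.1).sub (huc τ hτ)
      have hc2 : Continuous fun z => h • du τ z := (hduc τ hτ).const_smul h
      have hb1 : ∀ z, ‖u (τ + h) z - u τ z‖ ≤ B + B := fun z =>
        (norm_sub_le _ _).trans (add_le_add (hu0 _ hh2.1 z) (hu0 τ hτ z))
      have hb2 : ∀ z, ‖h • du τ z‖ ≤ |h| * D := fun z => by
        rw [norm_smul, Real.norm_eq_abs]; exact mul_le_mul_of_nonneg_left (hdu0 τ hτ z) (abs_nonneg _)
      rw [heatExtension_sub_of_bound hc1 hc2 hb1 hb2 hσp y, ← hsub, ← hsmul, smul_sub]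
      abel
    rw [hkey]
    -- the two bounds
    have hT : ∀ z, ‖u (τ + h) z - u τ z - h • du τ z‖ ≤ L * |h| ^ 2 := by
      intro z
      have := norm_sub_sub_smul_le_of_lipschitz_deriv (φ := fun σ => u σ z) (dφ := fun σ => du σ z)
        hL0 (fun σ hσ => hdu σ hσ z) (fun σ hσ σ' hσ' => hduL σ hσ σ' hσ' z) hτ hh2.1
      simpa using this
    calc ‖heatExtension (fun z => u (τ + h) z - u τ z - h • du τ z) (t - (τ + h)) y +
          h • (heatExtension (du τ) (t - (τ + h)) y - heatExtension (du τ) (t - τ) y)‖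
        ≤ ‖heatExtension (fun z => u (τ + h) z - u τ z - h • du τ z) (t - (τ + h)) y‖ +
            ‖h • (heatExtension (du τ) (t - (τ + h)) y - heatExtension (du τ) (t - τ) y)‖ :=
          norm_add_le _ _
      _ ≤ L * |h| ^ 2 + |h| * (ε / 2) := by
          refine add_le_add (norm_heatExtension_le hT hσp y) ?_
          rw [norm_smul, Real.norm_eq_abs]
          exact mul_le_mul_of_nonneg_left hh1.le (abs_nonneg _)
      _ = (L * |h| + ε / 2) * |h| := by ring
      _ ≤ (ε / 2 + ε / 2) * |h| := mul_le_mul_of_nonneg_right (add_le_add hh3 le_rfl) (abs_nonneg _)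
      _ = ε * ‖h‖ := by rw [Real.norm_eq_abs]; ring
  -- ### assembling
  have hsum := hii.add hi
  have hfun : (fun σ => heatExtension (u σ) (t - σ) y - heatExtension (u τ) (t - σ) y) +
      (fun σ => heatExtension (u τ) (t - σ) y) = fun σ => heatExtension (u σ) (t - σ) y := by
    funext σ; simp
  rw [hfun] at hsum
  simpa [sub_eq_add_neg] using hsum

/-! ### Duhamel's formula -/

/-- **Duhamel's formula for the heat flow of a classical field.** Under the hypotheses of
`hasDerivAt_heatExtension_timeDependent`, if moreover the Laplacians `Δu(τ)` are continuous,
bounded and Lipschitz in `τ` uniformly in space, and `q = ∂u - Δu`, then for `a < s < t < b`,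
`u(t)(y) = e^{(t-s)Δ}u(s)(y) + ∫ₛᵗ e^{(t-τ)Δ}q(τ)(y) dτ`
(fundamental theorem of calculus for `τ ↦ e^{(t-τ)Δ}u(τ)(y)` on `[s, t']` and `t' ↑ t`, using
`e^{σΔ}u(t) → u(t)` pointwise as `σ ↓ 0`). [cite: CoiculescuPalasek2025, §4.2–§4.3 (Duhamel formula); Evans, PDE, §2.3.1(c)] -/
theorem eq_heatExtension_add_integral {u du q : ℝ → E → F} {a b B B₁ B₂ D L BΔ LΔ : ℝ}
    (hL0 : 0 ≤ L) (hLΔ0 : 0 ≤ LΔ) (hC2 : ∀ τ ∈ Ioo a b, ContDiff ℝ 2 (u τ))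
    (hu0 : ∀ τ ∈ Ioo a b, ∀ z, ‖u τ z‖ ≤ B) (hu1 : ∀ τ ∈ Ioo a b, ∀ z, ‖fderiv ℝ (u τ) z‖ ≤ B₁)
    (hu2 : ∀ τ ∈ Ioo a b, ∀ z, ‖fderiv ℝ (fderiv ℝ (u τ)) z‖ ≤ B₂)
    (hdu : ∀ τ ∈ Ioo a b, ∀ z, HasDerivAt (fun σ => u σ z) (du τ z) τ)
    (hduc : ∀ τ ∈ Ioo a b, Continuous (du τ)) (hdu0 : ∀ τ ∈ Ioo a b, ∀ z, ‖du τ z‖ ≤ D)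
    (hduL : ∀ τ ∈ Ioo a b, ∀ τ' ∈ Ioo a b, ∀ z, ‖du τ' z - du τ z‖ ≤ L * |τ' - τ|)
    (hΔc : ∀ τ ∈ Ioo a b, Continuous fun z => (Δ (u τ)) z)
    (hΔ0 : ∀ τ ∈ Ioo a b, ∀ z, ‖(Δ (u τ)) z‖ ≤ BΔ)
    (hΔL : ∀ τ ∈ Ioo a b, ∀ τ' ∈ Ioo a b, ∀ z, ‖(Δ (u τ')) z - (Δ (u τ)) z‖ ≤ LΔ * |τ' - τ|)
    (hq : ∀ τ ∈ Ioo a b, ∀ z, q τ z = du τ z - (Δ (u τ)) z)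
    {s t : ℝ} (has : a < s) (hst : s < t) (htb : t < b) (y : E) :
    u t y = heatExtension (u s) (t - s) y + ∫ τ in s..t, heatExtension (q τ) (t - τ) y := by
  have huc : ∀ τ ∈ Ioo a b, Continuous (u τ) := fun τ hτ => (hC2 τ hτ).continuous
  have ht : t ∈ Ioo a b := ⟨has.trans hst, htb⟩
  have hs : s ∈ Ioo a b := ⟨has, hst.trans htb⟩
  -- the function and its derivative
  set Ψ : ℝ → F := fun σ => heatExtension (u σ) (t - σ) y with hΨ
  set Ψ' : ℝ → F := fun σ => heatExtension (du σ) (t - σ) y -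
    heatExtension (fun z => (Δ (u σ)) z) (t - σ) y with hΨ'
  have hder : ∀ σ ∈ Ioo a t, HasDerivAt Ψ (Ψ' σ) σ := fun σ hσ =>
    hasDerivAt_heatExtension_timeDependent hL0 hC2 hu0 hu1 hu2 hdu hduc hdu0 hduL
      ⟨hσ.1, hσ.2.trans htb⟩ hσ.2 y
  have hcont : ∀ σ ∈ Ioo a t, ContinuousAt Ψ' σ := fun σ hσ =>
    (continuousAt_heatExtension_timeDependent hL0 hduc hdu0 hduL ⟨hσ.1, hσ.2.trans htb⟩ hσ.2 y).sub
      (continuousAt_heatExtension_timeDependent (h := fun σ z => (Δ (u σ)) z) hLΔ0 hΔc hΔ0 hΔL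
        ⟨hσ.1, hσ.2.trans htb⟩ hσ.2 y)
  have hbound : ∀ σ ∈ Ioo a t, ‖Ψ' σ‖ ≤ D + BΔ := fun σ hσ => by
    have hσb : σ ∈ Ioo a b := ⟨hσ.1, hσ.2.trans htb⟩
    have hp : 0 < t - σ := sub_pos.2 hσ.2
    exact (norm_sub_le _ _).trans (add_le_add (norm_heatExtension_le (hdu0 σ hσb) hp y)
      (norm_heatExtension_le (hΔ0 σ hσb) hp y))
  -- integrability of `Ψ'` on `[s, t]`
  have hint : IntervalIntegrable Ψ' volume s t := by
    rw [intervalIntegrable_iff_integrableOn_Ioo_of_le hst.le]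
    have hmeas : AEStronglyMeasurable Ψ' (volume.restrict (Ioo s t)) :=
      (ContinuousOn.aestronglyMeasurable (fun σ hσ => (hcont σ ⟨has.trans hσ.1, hσ.2⟩).continuousWithinAt)
        measurableSet_Ioo)
    have hconst : IntegrableOn (fun _ : ℝ => D + BΔ) (Ioo s t) volume :=
      ((intervalIntegrable_const (μ := volume) (a := s) (b := t) (c := D + BΔ)).1).mono_set
        Ioo_subset_Ioc_self
    exact Integrable.mono' hconst hmeas
      (ae_restrict_of_forall_mem measurableSet_Ioo fun σ hσ => hbound σ ⟨has.trans hσ.1, hσ.2⟩)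
  -- ### the fundamental theorem of calculus on `[s, t']`
  have hFTC : ∀ t' ∈ Ioo s t, Ψ t' = Ψ s + ∫ σ in s..t', Ψ' σ := by
    intro t' ht'
    have hsub : uIcc s t' ⊆ Ioo a t := by
      rw [uIcc_of_le ht'.1.le]; exact fun σ hσ => ⟨has.trans_le hσ.1, hσ.2.trans_lt ht'.2⟩
    have h1 := intervalIntegral.integral_eq_sub_of_hasDerivAt (fun σ hσ => hder σ (hsub hσ))
      (hint.mono_set (by rw [uIcc_of_le ht'.1.le, uIcc_of_le hst.le]; exact Icc_subset_Icc_right ht'.2.le))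
    rw [h1]; abel
  -- ### the limit `t' ↑ t` of the left-hand side
  have hmem : ∀ᶠ t' in 𝓝[<] t, t' ∈ Ioo s t := Ioo_mem_nhdsLT hst
  have hlhs : Tendsto Ψ (𝓝[<] t) (𝓝 (u t y)) := by
    -- `e^{(t-t')Δ}u(t)(y) → u(t)(y)`
    have hm : MemLp (u t) ∞ (volume : Measure E) := memLp_top_of_continuous_of_bound (huc t ht) (hu0 t ht)
    have hA0 := tendsto_heatExtension_nhdsGT_zero_of_continuousAt hm le_top (huc t ht).continuousAt (x := y)
    have hσ : Tendsto (fun t' : ℝ => t - t') (𝓝[<] t) (𝓝[>] 0) := by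
      rw [tendsto_nhdsWithin_iff]
      refine ⟨?_, ?_⟩
      · have hc : Continuous fun t' : ℝ => t - t' := by fun_prop
        simpa using (hc.tendsto t).mono_left nhdsWithin_le_nhds
      · exact eventually_nhdsWithin_of_forall fun t' ht' => mem_Ioi.2 (sub_pos.2 ht')
    have hA : Tendsto (fun t' => heatExtension (u t) (t - t') y) (𝓝[<] t) (𝓝 (u t y)) := hA0.comp hσ
    -- `e^{(t-t')Δ}(u(t') - u(t))(y) → 0`
    have hB : Tendsto (fun t' => Ψ t' - heatExtension (u t) (t - t') y) (𝓝[<] t) (𝓝 0) := by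
      have hD : Tendsto (fun t' : ℝ => D * |t' - t|) (𝓝[<] t) (𝓝 0) := by
        have hc : Continuous fun t' : ℝ => D * |t' - t| := by fun_prop
        simpa using (hc.tendsto t).mono_left nhdsWithin_le_nhds
      refine squeeze_zero_norm' ?_ hD
      filter_upwards [hmem] with t' ht'
      have ht'b : t' ∈ Ioo a b := ⟨has.trans ht'.1, ht'.2.trans htb⟩
      have hp : 0 < t - t' := sub_pos.2 ht'.2
      rw [hΨ]
      dsimp only
      rw [← heatExtension_sub_of_bound (huc t' ht'b) (huc t ht) (hu0 t' ht'b) (hu0 t ht) hp y]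
      exact norm_heatExtension_le (fun z => norm_sub_le_of_deriv_bound (φ := fun σ => u σ z)
        (fun σ hσ => hdu σ hσ z) (fun σ hσ => hdu0 σ hσ z) ht ht'b) hp y
    have := hB.add hA
    simpa using this
  -- ### the limit `t' ↑ t` of the right-hand side
  have hM : 0 ≤ D + BΔ := (norm_nonneg _).trans (hbound s ⟨has, hst⟩)
  have hne : ∀ᵐ σ ∂(volume : Measure ℝ), σ ≠ t := by rw [ae_iff]; simp
  have hrhs : Tendsto (fun t' => Ψ s + ∫ σ in s..t', Ψ' σ) (𝓝[<] t)
      (𝓝 (Ψ s + ∫ σ in s..t, Ψ' σ)) := by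
    refine tendsto_const_nhds.add ?_
    rw [Metric.tendsto_nhdsWithin_nhds]
    intro ε hε
    refine ⟨min (t - s) (ε / (D + BΔ + 1)), lt_min (sub_pos.2 hst) (div_pos hε (by linarith)), ?_⟩
    intro t' ht't hdist
    have ht't : t' < t := ht't
    have hd : dist t' t = t - t' := by
      rw [Real.dist_eq, abs_sub_comm, abs_of_pos (sub_pos.2 ht't)]
    have hdist1 : t - t' < t - s := by rw [← hd]; exact lt_of_lt_of_le hdist (min_le_left _ _)
    have hdist2 : t - t' < ε / (D + BΔ + 1) := by
      rw [← hd]; exact lt_of_lt_of_le hdist (min_le_right _ _)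
    have hlt : s < t' := by linarith
    have hii : IntervalIntegrable Ψ' volume s t' :=
      hint.mono_set (by
        rw [uIcc_of_le hlt.le, uIcc_of_le hst.le]; exact Icc_subset_Icc_right ht't.le)
    rw [dist_eq_norm, ← norm_neg, neg_sub, intervalIntegral.integral_interval_sub_left hint hii]
    have hae : ∀ᵐ σ ∂(volume : Measure ℝ), σ ∈ uIoc t' t → ‖Ψ' σ‖ ≤ D + BΔ := by
      filter_upwards [hne] with σ hσne hσ
      rw [uIoc_of_le ht't.le] at hσ
      exact hbound σ ⟨has.trans (hlt.trans hσ.1), lt_of_le_of_ne hσ.2 hσne⟩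
    calc ‖∫ σ in t'..t, Ψ' σ‖ ≤ (D + BΔ) * |t - t'| :=
          intervalIntegral.norm_integral_le_of_norm_le_const_ae hae
      _ ≤ (D + BΔ) * (ε / (D + BΔ + 1)) := by
          rw [abs_of_pos (sub_pos.2 ht't)]; exact mul_le_mul_of_nonneg_left hdist2.le hM
      _ < ε := by rw [mul_div_assoc', div_lt_iff₀ (by linarith)]; nlinarith
  -- ### conclusion
  have hrhs' : Tendsto Ψ (𝓝[<] t) (𝓝 (Ψ s + ∫ σ in s..t, Ψ' σ)) :=
    hrhs.congr' (by filter_upwards [hmem] with t' ht'; exact (hFTC t' ht').symm)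
  have heq : u t y = Ψ s + ∫ σ in s..t, Ψ' σ := tendsto_nhds_unique hlhs hrhs'
  rw [heq]
  congr 1
  refine intervalIntegral.integral_congr_ae ?_
  filter_upwards [hne] with σ hσne hσ
  rw [uIoc_of_le hst.le] at hσ
  have hσt : σ < t := lt_of_le_of_ne hσ.2 hσne
  have hσ' : σ ∈ Ioo a b := ⟨has.trans hσ.1, hσt.trans htb⟩
  have hp : 0 < t - σ := sub_pos.2 hσt
  rw [hΨ']
  dsimp only
  rw [← heatExtension_sub_of_bound (hduc σ hσ') (hΔc σ hσ') (hdu0 σ hσ') (hΔ0 σ hσ') hp y]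
  congr 1
  funext z
  exact (hq σ hσ' z).symm

end HeatFlow

end Literature.Analysis.UnboundedOperators
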